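import Literature.Computability.Cryptography.ShorOrderFindingQuantum
import Literature.Computability.Cryptography.ShorOrdPost
import HarnessLib

/-!
# Shor's continued-fraction recovery as integer Euclid: the specification of the machine

Family `PQC` (trunk `CryptoQuantFine`); towards the programming fact `orderFindingPost_mem_FP`
of `ShorOrderFindingQuantum.lean`. The post-processor reads the order off a phase estimate
`ξ = A/D` through `Shor1997.candidate n q ξ` — *the least denominator `0 < r' < n` of a fraction
within `1/2q` of `ξ`* (`ShorOrderFindingAnalysis.lean`), a specification by unbounded search.
Shor (1997, §5): "this fraction can be found in polynomial time by using a continued fraction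
expansion". This file proves that claim in the form the machine uses:

* `natConv a b k` — the `k`-th convergent of `a/b` by Euclid's algorithm (stop when the remainder
  vanishes), and `natConv_eq_convergent : natConv a b k = Real.convergent (a/b) k` (Mathlib's
  recursive `⌊ξ⌋ + (convergent (fract ξ)⁻¹ k)⁻¹`, with `0⁻¹ = 0` handling rationals);
* `quots a b fuel` (the quotient list), `evalFrac` (a quotient list evaluated from the back as a
  fraction `(p, q)`), `evalFrac_coprime` (in lowest terms), `natConv_eq_evalFrac`;
* `cfStep`/`cfFwd` — the **forward recurrence** `p_k = a_k p_{k-1} + p_{k-2}`,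
  `q_k = a_k q_{k-1} + q_{k-2}` (what a machine computes in one pass), and `cfFwd_eq_evalFrac`,
  by the matrix form `∏ [[aᵢ, 1], [1, 0]]` (Hardy–Wright, Thm. 149/150: continuants);
* `length_quots_le` — Euclid on `b < 2^s` produces at most `2s` quotients, so fuel `2s + 1` is
  complete (`quots_eq_of_le`; every two steps halve
  the remainder; CLRS Lemma 31.10/Thm. 31.11, elementary form);
* `cfCandidate n q A D K` — scan the convergents `k < K` of `A/D` for one with denominator
  `0 < q_k < n` and `2q·|A q_k − p_k D| ≤ D q_k`, output its denominator, else `0`; and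
  **`cfCandidate_eq_candidate`**: for `n² ≤ q` and `K` beyond the length of the expansion this
  *is* `Shor1997.candidate n q (A/D)` (Legendre's theorem, Mathlib's
  `Real.exists_rat_eq_convergent`: a fraction within `1/2q ≤ 1/2n² < 1/2r'²` is a convergent;
  uniqueness of the candidate value, `Shor1997.approximant_unique`; lowest terms).

## References

* P. W. Shor, SIAM J. Comput. 26 (1997) 1484–1509, §5 (p. 15 of arXiv:quant-ph/9508027v2).
* G. H. Hardy, E. M. Wright, *An Introduction to the Theory of Numbers*, 6th ed. 2008, Ch. X,
  §10.2 (Thm. 149, 150: continuants and the recurrence), §10.15 (Thm. 184, Legendre).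
* T. H. Cormen, C. E. Leiserson, R. L. Rivest, C. Stein, *Introduction to Algorithms*, 3rd ed.
  2009, §31.2 (Lemma 31.10, Thm. 31.11: the number of recursive calls of EUCLID).
-/

noncomputable section

namespace Literature.Computability.Cryptography

namespace OFPostCF

open Real Kitaev1995 _root_.Computability Complexity Finset

/-! ### Euclid convergents and Mathlib's `Real.convergent` -/

/-- The `k`-th continued-fraction convergent of `a/b` by Euclid's algorithm: integer part
`a / b`, then recurse on `b / (a mod b)` unless the remainder vanishes.
[cite: HardyWright2008, §10.2 (Thm 149)] -/
def natConv : ℕ → ℕ → ℕ → ℚ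
  | a, b, 0 => ((a / b : ℕ) : ℚ)
  | a, b, k + 1 => ((a / b : ℕ) : ℚ) + if a % b = 0 then 0 else (natConv b (a % b) k)⁻¹

/-- **Euclid computes the convergents**: `natConv a b k` is Mathlib's `Real.convergent (a/b) k`.
[cite: HardyWright2008, §10.2 (Thm 149)] -/
theorem natConv_eq_convergent {b : ℕ} (hb : 0 < b) (a : ℕ) (k : ℕ) :
    (natConv a b k : ℝ) = Real.convergent ((a : ℝ) / b) k := by
  induction k generalizing a b with
  | zero =>
    have h0 : (0 : ℝ) ≤ (a : ℝ) / b := by positivity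
    rw [natConv, Real.convergent_zero, ← Int.natCast_floor_eq_floor h0, Nat.floor_div_eq_div]
    push_cast; rfl
  | succ k ih =>
    have h0 : (0 : ℝ) ≤ (a : ℝ) / b := by positivity
    rw [natConv, Real.convergent_succ, ← Int.natCast_floor_eq_floor h0, Nat.floor_div_eq_div,
      Int.fract_div_natCast_eq_div_natCast_mod]
    push_cast
    congr 1
    by_cases hr : a % b = 0
    · rw [if_pos hr, hr]; simp
    · rw [if_neg hr, Rat.cast_inv, ih (Nat.pos_of_ne_zero hr) b, inv_div]

/-! ### Quotient lists evaluated from the back -/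

/-- The first `fuel` quotients of Euclid's algorithm on `(a, b)` (empty once `b = 0`).
[cite: HardyWright2008, §10.6 (the continued fraction algorithm)] -/
def quots : ℕ → ℕ → ℕ → List ℕ
  | _, _, 0 => []
  | a, b, f + 1 => if b = 0 then [] else (a / b) :: quots b (a % b) f

/-- A quotient list evaluated from the back as a fraction `(numerator, denominator)`:
`[] ↦ 1/0` (so that `a + 1/∞ = a`), `a :: l ↦ a + 1/(l)`. [cite: HardyWright2008, §10.2 (Thm 149)] -/
def evalFrac : List ℕ → ℕ × ℕ
  | [] => (1, 0)
  | a :: l => (a * (evalFrac l).1 + (evalFrac l).2, (evalFrac l).1)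

/-- Numerator and denominator of an evaluated quotient list are coprime.
[cite: HardyWright2008, §10.2 (Thm 150, (ii))] -/
theorem evalFrac_coprime : ∀ l : List ℕ, Nat.Coprime (evalFrac l).1 (evalFrac l).2
  | [] => by simp [evalFrac]
  | a :: l => by
    rw [evalFrac]
    simp only
    have ih := evalFrac_coprime l
    rw [Nat.Coprime, Nat.gcd_comm, Nat.add_comm, Nat.gcd_add_mul_right_right] at *
    rwa [Nat.gcd_comm]

/-- With fuel left and `b > 0` the quotient list starts with `a / b`. [folklore] -/
theorem quots_succ_of_pos {a b : ℕ} (hb : 0 < b) (f : ℕ) :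
    quots a b (f + 1) = (a / b) :: quots b (a % b) f := by
  rw [quots, if_neg hb.ne']

/-- The numerator of an evaluated Euclid quotient list (after the first quotient) is positive.
[folklore] -/
theorem evalFrac_quots_fst_pos : ∀ (f a b : ℕ), 0 < b → a % b ≠ 0 →
    0 < (evalFrac (quots b (a % b) f)).1
  | 0, a, b, _, _ => by simp [quots, evalFrac]
  | f + 1, a, b, hb, hr => by
    rw [quots_succ_of_pos (Nat.pos_of_ne_zero hr), evalFrac]
    have hq : 1 ≤ b / (a % b) := (Nat.one_le_div_iff (Nat.pos_of_ne_zero hr)).2 (Nat.mod_lt _ hb).le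
    have := evalFrac_coprime (quots (a % b) (b % (a % b)) f)
    simp only
    -- `q · p' + q'` with `q ≥ 1`: positive unless `p' = q' = 0`, impossible for coprime `p', q'`
    rcases Nat.eq_zero_or_pos (evalFrac (quots (a % b) (b % (a % b)) f)).1 with h0 | hpos
    · rw [h0, Nat.coprime_zero_left] at this
      rw [h0, this]; omega
    · nlinarith

/-- **Euclid's convergents as evaluated quotient lists.** [cite: HardyWright2008, §10.2 (Thm 149)] -/
theorem natConv_eq_evalFrac {b : ℕ} (hb : 0 < b) (a k : ℕ) :
    natConv a b k = (evalFrac (quots a b (k + 1))).1 / (evalFrac (quots a b (k + 1))).2 := by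
  induction k generalizing a b with
  | zero => simp [natConv, quots, hb.ne', evalFrac]
  | succ k ih =>
    rw [natConv, quots_succ_of_pos hb, evalFrac]
    simp only
    by_cases hr : a % b = 0
    · rw [if_pos hr, hr]
      simp [quots, evalFrac]
    · rw [if_neg hr, ih (Nat.pos_of_ne_zero hr) b]
      have hp : (0 : ℚ) < (evalFrac (quots b (a % b) (k + 1))).1 := by
        exact_mod_cast evalFrac_quots_fst_pos (k + 1) a b hb hr
      push_cast
      field_simp

/-! ### The forward recurrence (continuants) -/

/-- One step of the forward recurrence on `(p_k, q_k, p_{k-1}, q_{k-1})`: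
`p_{k+1} = a p_k + p_{k-1}`, `q_{k+1} = a q_k + q_{k-1}`. [cite: HardyWright2008, §10.2 (Thm 149)] -/
def cfStep (s : ℕ × ℕ × ℕ × ℕ) (a : ℕ) : ℕ × ℕ × ℕ × ℕ :=
  (a * s.1 + s.2.2.1, a * s.2.1 + s.2.2.2, s.1, s.2.1)

/-- The forward recurrence over a quotient list, from `(p_{-1}, q_{-1}, p_{-2}, q_{-2}) = (1, 0, 0, 1)`.
[cite: HardyWright2008, §10.2 (Thm 149)] -/
def cfFwd (l : List ℕ) : ℕ × ℕ × ℕ × ℕ := l.foldl cfStep (1, 0, 0, 1)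

/-- The matrix `∏ [[aᵢ, 1], [1, 0]]` of a quotient list. [cite: HardyWright2008, §10.2 (Thm 150)] -/
def cfMat (l : List ℕ) : Matrix (Fin 2) (Fin 2) ℕ := (l.map fun a => !![a, 1; 1, 0]).prod

/-- The matrix of a list with a new first quotient. [folklore] -/
theorem cfMat_cons (a : ℕ) (l : List ℕ) : cfMat (a :: l) = !![a, 1; 1, 0] * cfMat l := by
  simp [cfMat]

/-- The matrix of a list with a new last quotient. [folklore] -/
theorem cfMat_append_singleton (l : List ℕ) (a : ℕ) : cfMat (l ++ [a]) = cfMat l * !![a, 1; 1, 0] := by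
  simp [cfMat]

/-- The back evaluation is the first column of the matrix. [cite: HardyWright2008, §10.2 (Thm 150)] -/
theorem evalFrac_eq_cfMat : ∀ l : List ℕ, evalFrac l = (cfMat l 0 0, cfMat l 1 0)
  | [] => by simp [evalFrac, cfMat]
  | a :: l => by
    rw [evalFrac, evalFrac_eq_cfMat l, cfMat_cons]
    simp [Matrix.mul_apply, Fin.sum_univ_two]

/-- The forward recurrence computes the whole matrix. [cite: HardyWright2008, §10.2 (Thm 150)] -/
theorem cfFwd_eq_cfMat (l : List ℕ) : cfFwd l = (cfMat l 0 0, cfMat l 1 0, cfMat l 0 1, cfMat l 1 1) := by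
  induction l using List.reverseRecOn with
  | nil => simp [cfFwd, cfMat]
  | append_singleton l a ih =>
    rw [cfFwd, List.foldl_append, List.foldl_cons, List.foldl_nil, ← cfFwd, ih, cfStep, cfMat_append_singleton]
    simp [Matrix.mul_apply, Fin.sum_univ_two, Nat.mul_comm]

/-- **The forward recurrence computes the convergents** `(p_k, q_k)` of the back evaluation.
[cite: HardyWright2008, §10.2 (Thm 149)] -/
theorem cfFwd_eq_evalFrac (l : List ℕ) : ((cfFwd l).1, (cfFwd l).2.1) = evalFrac l := by
  rw [cfFwd_eq_cfMat, evalFrac_eq_cfMat]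

/-! ### The length of the expansion -/

/-- A quotient list has at most `fuel` entries. [folklore] -/
theorem length_quots_le_fuel : ∀ (a b f : ℕ), (quots a b f).length ≤ f
  | a, b, 0 => by simp [quots]
  | a, b, f + 1 => by
    rw [quots]
    split_ifs
    · simp
    · simpa using length_quots_le_fuel b (a % b) f

/-- **Euclid halves the second operand every two steps**: with `b < 2^s`, the expansion has at
most `2s` quotients. (Elementary form of Lamé's theorem.) [cite: CLRS2009, §31.2 (Lemma 31.10, Thm 31.11)] -/
theorem length_quots_le : ∀ (s a b f : ℕ), b < 2 ^ s → (quots a b f).length ≤ 2 * s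
  | 0, a, b, f, hb => by
    have : b = 0 := by simpa using hb
    subst this
    cases f <;> simp [quots]
  | s + 1, a, b, 0, _ => by simp [quots]
  | s + 1, a, b, 1, _ => by
    rw [quots]
    split_ifs
    · simp
    · simp [quots]; omega
  | s + 1, a, b, f + 2, hb => by
    by_cases hb0 : b = 0
    · simp [quots, hb0]
    rw [quots_succ_of_pos (Nat.pos_of_ne_zero hb0)]
    by_cases hr0 : a % b = 0
    · simp [quots, hr0]; omega
    rw [quots_succ_of_pos (Nat.pos_of_ne_zero hr0), List.length_cons, List.length_cons]
    -- two steps: the next second operand `b % (a % b)` is `< b / 2 < 2^s`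
    have key : b % (a % b) < 2 ^ s := by
      have h1 : a % b < b := Nat.mod_lt _ (Nat.pos_of_ne_zero hb0)
      have h2 : b % (a % b) < a % b := Nat.mod_lt _ (Nat.pos_of_ne_zero hr0)
      by_cases hc : 2 * (a % b) ≤ b
      · rw [pow_succ] at hb; omega
      · have : b % (a % b) = b - a % b := by
          rw [Nat.mod_eq_sub_mod h1.le, Nat.mod_eq_of_lt (by omega)]
        rw [pow_succ] at hb; omega
    have := length_quots_le s (a % b) (b % (a % b)) f key
    omega

/-- A quotient list that did not exhaust its fuel is complete: more fuel changes nothing. [folklore] -/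
theorem quots_succ_eq_of_length_lt : ∀ (a b f : ℕ), (quots a b f).length < f → quots a b (f + 1) = quots a b f
  | a, b, 0, h => by simp at h
  | a, b, f + 1, h => by
    by_cases hb : b = 0
    · simp [quots, hb]
    · rw [quots_succ_of_pos (Nat.pos_of_ne_zero hb)] at h ⊢
      rw [quots_succ_of_pos (Nat.pos_of_ne_zero hb), quots_succ_eq_of_length_lt b (a % b) f (by simpa using h)]

/-- **Stability of the expansion**: beyond `2s + 1` steps of fuel (`b < 2^s`) the quotient list is
complete. [folklore] -/
theorem quots_eq_of_le {s a b : ℕ} (hb : b < 2 ^ s) : ∀ {f : ℕ}, 2 * s + 1 ≤ f → quots a b f = quots a b (2 * s + 1) := by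
  intro f hf
  obtain ⟨j, rfl⟩ := Nat.exists_eq_add_of_le hf
  induction j with
  | zero => rfl
  | succ j ih =>
    rw [← Nat.add_assoc, quots_succ_eq_of_length_lt _ _ _ ?_, ih (by omega)]
    rw [ih (by omega)]
    have := length_quots_le s a b (2 * s + 1) hb
    omega

/-- Hence every convergent of `a/b` (`b < 2^s`) already occurs among the first `2s + 1`. [folklore] -/
theorem natConv_eq_of_le {s a b : ℕ} (hb0 : 0 < b) (hb : b < 2 ^ s) {m : ℕ} (hm : 2 * s ≤ m) :
    natConv a b m = natConv a b (2 * s) := by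
  rw [natConv_eq_evalFrac hb0, natConv_eq_evalFrac hb0, quots_eq_of_le hb (by omega)]

/-! ### The candidate by continued fractions -/

/-- `|A/D − p/q'| ≤ 1/2q` in integers: `2q·|A q' − p D| ≤ D q'`. [folklore] -/
theorem abs_div_sub_div_le_iff {A D p q' q : ℕ} (hD : 0 < D) (hq' : 0 < q') (hq : 0 < q) :
    |(A : ℝ) / D - p / q'| ≤ 1 / (2 * q) ↔ 2 * q * |(A : ℤ) * q' - p * D| ≤ D * q' := by
  have hDr : (0 : ℝ) < D := by exact_mod_cast hD
  have hq'r : (0 : ℝ) < q' := by exact_mod_cast hq'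
  have hqr : (0 : ℝ) < q := by exact_mod_cast hq
  rw [show (A : ℝ) / D - p / q' = ((A : ℝ) * q' - p * D) / (D * q') by field_simp, abs_div,
    abs_of_pos (by positivity : (0 : ℝ) < D * q'), div_le_div_iff₀ (by positivity) (by positivity)]
  have cast : ((2 * q * |(A : ℤ) * q' - p * D| : ℤ) : ℝ) = 2 * q * |(A : ℝ) * q' - p * D| := by push_cast; ring_nf
  constructor
  · intro h
    have : ((2 * q * |(A : ℤ) * q' - p * D| : ℤ) : ℝ) ≤ ((D * q' : ℕ) : ℝ) := by
      rw [cast]; push_cast; nlinarith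
    exact_mod_cast this
  · intro h
    have : ((2 * q * |(A : ℤ) * q' - p * D| : ℤ) : ℝ) ≤ ((D * q' : ℕ) : ℝ) := by exact_mod_cast h
    rw [cast] at this; push_cast at this; nlinarith

/-- The test applied to the `k`-th convergent `p/q'` of `A/D`: `0 < q' < n` and
`2q·|A q' − p D| ≤ D q'`. [cite: Shor1997, §5 (continued fraction recovery of d/r)] -/
def cfTest (n q A D : ℕ) (pq : ℕ × ℕ) : Bool :=
  decide (0 < pq.2 ∧ pq.2 < n ∧ 2 * q * Int.natAbs ((A : ℤ) * pq.2 - pq.1 * D) ≤ D * pq.2)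

/-- **The candidate by continued fractions**: the denominator of the first convergent `k < K` of
`A/D` passing `cfTest`, or `0`. [cite: Shor1997, §5 (continued fraction recovery of d/r)] -/
def cfCandidate (n q A D K : ℕ) : ℕ :=
  match (List.range K).find? fun k => cfTest n q A D (evalFrac (quots A D (k + 1))) with
  | some k => (evalFrac (quots A D (k + 1))).2
  | none => 0

/-- `Int.natAbs` versus `|·|` in the test. [folklore] -/
theorem two_mul_natAbs_le_iff {q D q' : ℕ} (z : ℤ) :
    2 * q * z.natAbs ≤ D * q' ↔ 2 * (q : ℤ) * |z| ≤ D * q' := by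
  rw [← Int.natCast_natAbs, ← Nat.cast_le (α := ℤ)]; push_cast; rfl

/-- The denominator of a convergent of `A/D` (`D > 0`) is positive. [folklore] -/
theorem evalFrac_quots_snd_pos {D : ℕ} (hD : 0 < D) (A k : ℕ) : 0 < (evalFrac (quots A D (k + 1))).2 := by
  rw [quots_succ_of_pos hD, evalFrac]
  simp only
  by_cases hr : A % D = 0
  · rw [hr]; cases k <;> simp [quots, evalFrac]
  · exact evalFrac_quots_fst_pos k A D hD hr

/-- **Shor's recovery by continued fractions is correct**: for `n² ≤ q`, `0 < D < 2^s` and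
`K ≥ 2s + 1`, `cfCandidate n q A D K = Shor1997.candidate n q (A/D)`. If some convergent passes
the test it is a coprime fraction within `1/2q` with denominator `< n`, hence *the* candidate
(`Shor1997.candidate_eq`); if none does, no candidate exists, for by Legendre's theorem
(`Real.exists_rat_eq_convergent`; `|ξ − d'/r'| ≤ 1/2q ≤ 1/2n² < 1/2r'²`) a candidate fraction in
lowest terms is a convergent, which occurs among the first `2s + 1`.
[cite: Shor1997, §5 (continued fraction recovery of d/r); HardyWright2008, §10.15 Thm 184] -/
theorem cfCandidate_eq_candidate {n q A D s K : ℕ} (hq : n ^ 2 ≤ q) (hD : 0 < D) (hDs : D < 2 ^ s)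
    (hK : 2 * s + 1 ≤ K) : cfCandidate n q A D K = Shor1997.candidate n q ((A : ℝ) / D) := by
  classical
  -- the test in real form
  have htest : ∀ pq : ℕ × ℕ, cfTest n q A D pq = true ↔
      0 < pq.2 ∧ pq.2 < n ∧ |(A : ℝ) / D - pq.1 / pq.2| ≤ 1 / (2 * q) := by
    intro pq
    rw [cfTest, decide_eq_true_eq]
    constructor
    · rintro ⟨h0, hn, h⟩
      have hq0 : 0 < q := by nlinarith
      exact ⟨h0, hn, (abs_div_sub_div_le_iff hD h0 hq0).2 ((two_mul_natAbs_le_iff _).1 h)⟩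
    · rintro ⟨h0, hn, h⟩
      have hq0 : 0 < q := by nlinarith
      exact ⟨h0, hn, (two_mul_natAbs_le_iff _).2 ((abs_div_sub_div_le_iff hD h0 hq0).1 h)⟩
  rw [cfCandidate]
  split
  · -- some convergent passes the test: it is the candidate
    rename_i k hk
    have hpass := List.find?_some hk
    obtain ⟨h0, hn, hclose⟩ := (htest _).1 hpass
    symm
    refine Shor1997.candidate_eq (d := ((evalFrac (quots A D (k + 1))).1 : ℤ)) hq h0 hn
      (Nat.isCoprime_iff_coprime.2 (evalFrac_coprime _)) ?_
    simpa using hclose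
  · -- no convergent passes: there is no candidate
    rename_i hnone
    rw [Shor1997.candidate, dif_neg]
    rintro ⟨r', h0, hn, d', hd'⟩
    have hq0 : 0 < q := by nlinarith
    set v : ℚ := (d' : ℚ) / r' with hv
    have hvcast : (v : ℝ) = (d' : ℝ) / r' := by rw [hv]; push_cast; rfl
    -- the denominator of `v` in lowest terms divides `r'`
    have hvden : v.den ≤ r' := by
      refine Nat.le_of_dvd h0 ?_
      have := Rat.den_dvd d' r'
      rw [Rat.divInt_eq_div] at this
      push_cast at this
      rw [← hv] at this
      exact_mod_cast this
    -- Legendre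
    have hleg : |(A : ℝ) / D - v| < 1 / (2 * (v.den : ℝ) ^ 2) := by
      rw [hvcast]
      refine lt_of_le_of_lt hd' ?_
      have h1 : (v.den : ℝ) + 1 ≤ n := by exact_mod_cast lt_of_le_of_lt hvden hn
      have h2 : (0 : ℝ) < v.den := by exact_mod_cast v.den_pos
      have hQ : (n : ℝ) ^ 2 ≤ q := by exact_mod_cast hq
      rw [div_lt_div_iff₀ (by positivity) (by positivity)]
      nlinarith
    obtain ⟨m, hm⟩ := Real.exists_rat_eq_convergent hleg
    -- the convergent occurs among the first `2s + 1`
    set k := min m (2 * s) with hkdef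
    have hk : k < K := by omega
    have hvk : v = natConv A D k := by
      have e1 : (v : ℝ) = natConv A D m := by rw [hm, natConv_eq_convergent hD]
      have e2 : natConv A D m = natConv A D k := by
        by_cases hms : m ≤ 2 * s
        · rw [hkdef, min_eq_left hms]
        · rw [hkdef, min_eq_right (by omega)]
          exact natConv_eq_of_le hD hDs (by omega)
      exact_mod_cast e1.trans (congrArg _ e2)
    -- as a fraction in lowest terms
    set pq := evalFrac (quots A D (k + 1)) with hpq
    have hcop : Nat.Coprime pq.1 pq.2 := evalFrac_coprime _
    have hq'0 : 0 < pq.2 := evalFrac_quots_snd_pos hD A k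
    have hvfrac : v = (pq.1 : ℚ) / pq.2 := by rw [hvk, natConv_eq_evalFrac hD]
    have hdenq : v.den = pq.2 := by
      have := Rat.den_div_eq_of_coprime (a := pq.1) (b := pq.2) (by exact_mod_cast hq'0) (by simpa using hcop)
      have e : ((pq.1 : ℤ) : ℚ) / ((pq.2 : ℤ) : ℚ) = v := by rw [hvfrac]; push_cast; rfl
      rw [e] at this
      exact_mod_cast this
    -- so it passes the test: contradiction
    have hpass : cfTest n q A D pq = true := by
      refine (htest pq).2 ⟨hq'0, by rw [← hdenq]; exact lt_of_le_of_lt hvden hn, ?_⟩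
      have : (A : ℝ) / D - pq.1 / pq.2 = (A : ℝ) / D - v := by rw [hvfrac]; push_cast; rfl
      rw [this, hvcast]
      exact hd'
    have := List.find?_eq_none.1 hnone k (List.mem_range.2 hk)
    exact this hpass

/-! ### The distance to the nearest multiple of `N`, and `cdist` on `N`-ths -/

/-- The distance of `w < N` to the nearest multiple of `N`. [folklore] -/
def md (w N : ℕ) : ℕ := min w (N - w)

/-- **`cdist` of two `N`-ths is a modular distance**: `cdist (u/N) (v/N) = md ((u + N − v) mod N) / N`
for `v < N` (rounding half up and the symmetry of `min` agree at the midpoint).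
[cite: Kitaev1995, §3 Lemma 10 (distances on the circle)] -/
theorem cdist_div_eq {u v N : ℕ} (hN : 0 < N) (hv : v < N) :
    cdist ((u : ℚ) / N) ((v : ℚ) / N) = (md ((u + N - v) % N) N : ℚ) / N := by
  set w := (u + N - v) % N with hw
  set d := (u + N - v) / N with hd
  have hwN : w < N := Nat.mod_lt _ hN
  have hNq : (0 : ℚ) < N := by exact_mod_cast hN
  -- the difference is `w/N` up to an integer
  have hdiff : (u : ℚ) / N = (w : ℚ) / N + ((d : ℤ) - 1 : ℤ) + (v : ℚ) / N := by
    have h1 : ((u + N - v : ℕ) : ℚ) = u + N - v := by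
      rw [Nat.cast_sub (by omega)]; push_cast; ring
    have h2 : (u + N - v : ℕ) = N * d + w := (Nat.div_add_mod _ _).symm
    have h3 : ((u + N - v : ℕ) : ℚ) = (N : ℚ) * d + w := by exact_mod_cast h2
    rw [h1] at h3
    field_simp
    push_cast
    linarith
  rw [hdiff, show cdist ((w : ℚ) / N + (((d : ℤ) - 1 : ℤ) : ℚ) + (v : ℚ) / N) ((v : ℚ) / N) =
      cdist ((w : ℚ) / N + (((d : ℤ) - 1 : ℤ) : ℚ) + (v : ℚ) / N) (0 + (v : ℚ) / N) by rw [zero_add],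
    cdist_add_right, cdist_add_int, cdist, sub_zero]
  -- rounding `w/N ∈ [0, 1)`
  have hw0 : (0 : ℚ) ≤ w / N := by positivity
  have hw1 : (w : ℚ) / N < 1 := by rw [div_lt_one hNq]; exact_mod_cast hwN
  by_cases h2 : 2 * w < N
  · have hlt : (w : ℚ) / N < 1 / 2 := by
      rw [div_lt_div_iff₀ hNq (by norm_num)]
      have : ((2 * w : ℕ) : ℚ) < N := by exact_mod_cast h2
      push_cast at this; linarith
    have hr : round ((w : ℚ) / N) = 0 := by
      rw [round_eq_zero_iff]
      exact ⟨by linarith, hlt⟩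
    rw [hr, Int.cast_zero, sub_zero, abs_of_nonneg hw0, md, min_eq_left (by omega)]
  · have hge : (1 : ℚ) / 2 ≤ (w : ℚ) / N := by
      rw [div_le_div_iff₀ (by norm_num) hNq]
      have : (N : ℚ) ≤ ((2 * w : ℕ) : ℚ) := by exact_mod_cast not_lt.1 h2
      push_cast at this; linarith
    have hr : round ((w : ℚ) / N) = 1 := by
      rw [round_eq, Int.floor_eq_iff]
      constructor
      · push_cast; linarith
      · push_cast; linarith
    rw [hr, Int.cast_one, abs_of_nonpos (by linarith), neg_sub, md, min_eq_right (by omega),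
      Nat.cast_sub hwN.le, sub_div, div_self hNq.ne']

/-! ### Kitaev's refinement in integers -/

/-- The numerator (over `8`) of the quadrant centre: `1, 7, 3, 5`. [cite: Kitaev1995, §3 Lemma 10] -/
def kq (cpos spos : Bool) : ℕ := if cpos then (if spos then 1 else 7) else (if spos then 3 else 5)

/-- `kq < 8`. [folklore] -/
theorem kq_lt (cpos spos : Bool) : kq cpos spos < 8 := by
  unfold kq; split_ifs <;> norm_num

/-- The quadrant centre is `kq / 8`. [folklore] -/
theorem quadrantCenter_eq (cpos spos : Bool) : (quadrantCenter cpos spos : ℚ) = (kq cpos spos : ℚ) / 8 := by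
  unfold quadrantCenter kq; split_ifs <;> norm_num

/-- **Kitaev's refinement in integers**: the numerator of `refineAux` at depth `d` over `8·2^d`,
from level numerators `κ l` over `8`. At each step compare the modular distances of the two halves
`a/2 = A/N` and `(a+1)/2 = (A + N/2)/N` (`N = 8·2^{d+1}`) to the next localisation
`κ·2^{d+1}/N`. [cite: Kitaev1995, §3 Lemma 10] -/
def refineNat (κ : ℕ → ℕ) (L : ℕ) : ℕ → ℕ
  | 0 => κ (L - 1)
  | d + 1 =>
    let a := refineNat κ L d
    let N := 8 * 2 ^ (d + 1)
    let v := κ (L - 1 - (d + 1)) * 2 ^ (d + 1)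
    if md ((a + N - v) % N) N ≤ md ((a + N / 2 + N - v) % N) N then a else a + N / 2

/-- The integer refinement stays below `8·2^d`. [folklore] -/
theorem refineNat_lt {κ : ℕ → ℕ} (hκ : ∀ l, κ l < 8) (L : ℕ) : ∀ d, refineNat κ L d < 8 * 2 ^ d
  | 0 => by simpa [refineNat] using hκ (L - 1)
  | d + 1 => by
    have ih := refineNat_lt hκ L d
    rw [refineNat]
    have hN : 8 * 2 ^ (d + 1) / 2 = 8 * 2 ^ d := by rw [pow_succ]; omega
    split_ifs
    · rw [pow_succ]; omega
    · rw [hN, pow_succ]; omega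

/-- **The integer refinement is the refinement**: `refineAux (κ/8) L d = refineNat κ L d / (8·2^d)`.
[cite: Kitaev1995, §3 Lemma 10] -/
theorem refineAux_eq {κ : ℕ → ℕ} (hκ : ∀ l, κ l < 8) (L : ℕ) :
    ∀ d, refineAux (fun l => (κ l : ℚ) / 8) L d = (refineNat κ L d : ℚ) / (8 * 2 ^ d)
  | 0 => by simp [refineAux, refineNat]
  | d + 1 => by
    have ih := refineAux_eq hκ L d
    have hA := refineNat_lt hκ L d
    set A := refineNat κ L d with hAdef
    set N := 8 * 2 ^ (d + 1) with hNdef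
    set v := κ (L - 1 - (d + 1)) * 2 ^ (d + 1) with hvdef
    have hN0 : 0 < N := by rw [hNdef]; positivity
    have hN2 : N / 2 = 8 * 2 ^ d := by rw [hNdef, pow_succ]; omega
    have hvN : v < N := by
      rw [hvdef, hNdef]
      exact Nat.mul_lt_mul_of_lt_of_le (hκ _) le_rfl (by positivity)
    have hNq : (N : ℚ) = 8 * 2 ^ (d + 1) := by rw [hNdef]; push_cast; ring
    -- the two halves and the localisation as `N`-ths
    have e1 : (A : ℚ) / (8 * 2 ^ d) / 2 = (A : ℚ) / N := by rw [hNq, pow_succ]; ring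
    have e2 : ((A : ℚ) / (8 * 2 ^ d) + 1) / 2 = ((A + N / 2 : ℕ) : ℚ) / N := by
      rw [hN2, hNq]; push_cast; field_simp; ring
    have e3 : (κ (L - 1 - (d + 1)) : ℚ) / 8 = (v : ℚ) / N := by
      rw [hvdef, hNq]; push_cast; field_simp
    rw [refineAux, ih, halveTowards, e1, e2, e3, cdist_div_eq hN0 hvN, cdist_div_eq hN0 hvN, refineNat]
    simp only [← hAdef, ← hNdef, ← hvdef, Nat.cast_ite]
    have hiff : (md ((A + N - v) % N) N : ℚ) / N ≤ (md ((A + N / 2 + N - v) % N) N : ℚ) / N ↔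
        md ((A + N - v) % N) N ≤ md ((A + N / 2 + N - v) % N) N := by
      rw [div_le_div_iff_of_pos_right (by exact_mod_cast hN0), Nat.cast_le]
    by_cases h : md ((A + N - v) % N) N ≤ md ((A + N / 2 + N - v) % N) N
    · rw [if_pos (hiff.2 h), if_pos h, hNq]
    · rw [if_neg (fun h' => h (hiff.1 h')), if_neg h, hNq]

/-- The level numerators of trial `t`: `kq` of the two count tests, `0` beyond the levels.
[cite: Kitaev1995, §3 Lemma 10] -/
def levelNum (ℓ : ℕ) (γ : Fin (numControls ℓ) → Bool) (t : Fin numTrials) (l : ℕ) : ℕ :=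
  if h : l < numLevels ℓ then
    kq (decide (2 * cnt (t, ⟨l, h⟩, false) γ ≤ blockSize ℓ)) (decide (2 * cnt (t, ⟨l, h⟩, true) γ ≤ blockSize ℓ))
  else 0

/-- Level numerators are `< 8`. [folklore] -/
theorem levelNum_lt (ℓ : ℕ) (γ : Fin (numControls ℓ) → Bool) (t : Fin numTrials) (l : ℕ) : levelNum ℓ γ t l < 8 := by
  unfold levelNum; split_ifs
  · exact kq_lt _ _
  · norm_num

/-- **The phase estimate as a dyadic rational**: `phaseEst = refineNat levelNum L (L−1) / (8·2^{L−1})`,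
`L = numLevels ℓ`. [cite: Kitaev1995, §3 Lemma 10] -/
theorem phaseEst_eq (ℓ : ℕ) (γ : Fin (numControls ℓ) → Bool) (t : Fin numTrials) :
    phaseEst ℓ γ t = (refineNat (levelNum ℓ γ t) (numLevels ℓ) (numLevels ℓ - 1) : ℚ) / (8 * 2 ^ (numLevels ℓ - 1)) := by
  rw [phaseEst, refined, ← refineAux_eq (levelNum_lt ℓ γ t)]
  congr 1
  funext l
  unfold levelNum levelEst
  split_ifs <;> simp [quadrantCenter_eq]

/-! ### Block counts as windows of the measured string -/

/-- Counting the ones of a window `[D, D + B)` of a string (missing bits read `0`). [folklore] -/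
theorem count_take_drop_eq_sum : ∀ (y : List Bool) (D B : ℕ),
    ((y.drop D).take B).count true = ∑ i : Fin B, (y.getD (D + i) false).toNat
  | [], D, B => by simp
  | b :: y, D + 1, B => by
    rw [List.drop_succ_cons, count_take_drop_eq_sum y D B]
    refine Finset.sum_congr rfl fun i _ => ?_
    rw [show D + 1 + (i : ℕ) = (D + i) + 1 by omega, List.getD_cons_succ]
  | b :: y, 0, 0 => by simp
  | b :: y, 0, B + 1 => by
    rw [List.drop_zero, List.take_succ_cons, List.count_cons, Fin.sum_univ_succ,
      show y.take B = (y.drop 0).take B by simp, count_take_drop_eq_sum y 0 B, Nat.add_comm]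
    simp only [Fin.val_zero, add_zero, List.getD_cons_zero, Fin.val_succ, zero_add]
    congr 1
    cases b <;> simp

/-- The inverse layout, retyped on `Fin (4 · (Lv · 2B))` so that `simp` can evaluate it. [folklore] -/
theorem layout_symm_apply' {ℓ : ℕ} (p : TestLabel ℓ) :
    (layout ℓ).symm p = ((finProdFinEquiv.symm.trans <| Equiv.prodCongr (Equiv.refl _) <|
      finProdFinEquiv.symm.trans <| Equiv.prodCongr (Equiv.refl _) <|
        finProdFinEquiv.symm.trans <| Equiv.prodCongr finTwoEquiv (Equiv.refl _)) :
          Fin (numTrials * (numLevels ℓ * (2 * blockSize ℓ))) ≃ TestLabel ℓ).symm p := rfl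

/-- `finTwoEquiv.symm` as a number. [folklore] -/
theorem val_finTwoEquiv_symm (b : Bool) : ((finTwoEquiv.symm b : Fin 2) : ℕ) = b.toNat := by
  cases b <;> rfl

/-- **The position of control `(t, l, σ, i)`**: `t·(Lv·2B) + l·2B + σ·B + i`. [folklore] -/
theorem val_layout_symm {ℓ : ℕ} (t : Fin numTrials) (l : Fin (numLevels ℓ)) (σ : Bool) (i : Fin (blockSize ℓ)) :
    (((layout ℓ).symm (t, l, σ, i) : Fin (numControls ℓ)) : ℕ) =
      t * (numLevels ℓ * (2 * blockSize ℓ)) + (l * (2 * blockSize ℓ) + (σ.toNat * blockSize ℓ + i)) := by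
  rw [layout_symm_apply']
  simp [val_finTwoEquiv_symm]
  ring

/-- **A block count is the number of ones in a window of the measured string.**
[cite: Kitaev1995, §3 (before Lemma 9: "count how many 1's")] -/
theorem cnt_readControls (ℓ : ℕ) (y : List Bool) (t : Fin numTrials) (l : Fin (numLevels ℓ)) (σ : Bool) :
    cnt (t, l, σ) (readControls ℓ y) =
      ((y.drop (ℓ + (t * (numLevels ℓ * (2 * blockSize ℓ)) + (l * (2 * blockSize ℓ) + σ.toNat * blockSize ℓ)))).take
        (blockSize ℓ)).count true := by
  rw [cnt, block_eq_image, filter_image, card_image_of_injective _ fun i i' h => by simpa using h,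
    count_take_drop_eq_sum, card_filter]
  refine Finset.sum_congr rfl fun i _ => ?_
  simp only [readControls, val_layout_symm]
  rw [show ℓ + (↑t * (numLevels ℓ * (2 * blockSize ℓ)) + (↑l * (2 * blockSize ℓ) + σ.toNat * blockSize ℓ)) + ↑i =
    ℓ + (↑t * (numLevels ℓ * (2 * blockSize ℓ)) + (↑l * (2 * blockSize ℓ) + (σ.toNat * blockSize ℓ + ↑i))) by ring]
  cases y.getD _ false <;> simp

/-! ### The post-processor in closed form -/

/-- The pair decoder of the instance never fails. [folklore] -/
theorem natPairEncoding_decode (w : List Bool) :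
    natPairEncoding.decode w = some (decodeNat (boolUnpair w).1, decodeNat (boolUnpair w).2) := rfl

/-- The second component of `boolUnpair` is empty or at least two symbols shorter. [folklore] -/
theorem boolUnpair_snd_shape : ∀ w : List Bool, (boolUnpair w).2 = [] ∨ (boolUnpair w).2.length + 2 ≤ w.length
  | [] => Or.inl rfl
  | [_] => Or.inl rfl
  | b :: b' :: rest => by
    rw [boolUnpair]
    split_ifs
    · rcases boolUnpair_snd_shape rest with h | h
      · exact Or.inl h
      · right; simp only [List.length_cons]; omega
    · right; simp
    · exact Or.inl rfl

/-- **The modulus read off an instance of length `ℓ` satisfies `n² ≤ 4^ℓ = qOf ℓ`** (by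
`Literature.Computability.Cryptography.decodeNat_lt` of `ShorFactoring.lean`: `decodeNat l < 2^{|l|+1}`) — so Shor's uniqueness of
the candidate fraction (`approximant_unique`) always applies. [folklore] -/
theorem sq_decode_le_qOf (w : List Bool) : (decodeNat (boolUnpair w).2) ^ 2 ≤ qOf w.length := by
  rw [qOf]
  rcases boolUnpair_snd_shape w with h | h
  · rw [h]; simp [decodeNat, decodeNum]
  · have h1 := Literature.Computability.Cryptography.decodeNat_lt (boolUnpair w).2
    have h2 : 2 ^ ((boolUnpair w).2.length + 1) ≤ 2 ^ w.length := Nat.pow_le_pow_right (by norm_num) (by omega)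
    calc decodeNat (boolUnpair w).2 ^ 2 ≤ (2 ^ w.length) ^ 2 := Nat.pow_le_pow_left (h1.le.trans h2) 2
      _ = 2 ^ (2 * w.length) := by rw [← pow_mul, Nat.mul_comm]

/-- **The order estimate by integer arithmetic and continued fractions**: for `n² ≤ 4^ℓ`,
`orderEst n ℓ γ` is the `lcm` over the trials of `cfCandidate n 4^ℓ A_t 2^{L+2} (2L+7)` with
`A_t = refineNat (levelNum t) L (L−1)`, `L = 2ℓ+1`. [cite: Kitaev1995, §3 Thm 1 and §4; Shor1997, §5] -/
theorem orderEst_eq {n ℓ : ℕ} (hn : n ^ 2 ≤ qOf ℓ) (γ : Fin (numControls ℓ) → Bool) :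
    orderEst n ℓ γ = univ.lcm fun t : Fin numTrials =>
      cfCandidate n (qOf ℓ) (refineNat (levelNum ℓ γ t) (numLevels ℓ) (numLevels ℓ - 1))
        (2 ^ (numLevels ℓ + 2)) (2 * (numLevels ℓ + 3) + 1) := by
  rw [orderEst]
  refine congrArg _ (funext fun t => ?_)
  rw [phaseEst_eq, cfCandidate_eq_candidate (s := numLevels ℓ + 3) hn (by positivity)
    (Nat.pow_lt_pow_right (by norm_num) (by omega)) le_rfl]
  congr 1
  have hL : 1 ≤ numLevels ℓ := by simp [numLevels]
  push_cast
  rw [show (8 : ℝ) * 2 ^ (numLevels ℓ - 1) = 2 ^ (numLevels ℓ + 2) by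
    rw [show numLevels ℓ + 2 = (numLevels ℓ - 1) + 3 by omega, pow_add]; norm_num; ring]

/-- **The order-finding post-processor in closed form.** On every input `z = ⟨w, y⟩`:
`orderFindingPost z = bin (lcm_t cfCandidate n' 4^ℓ A_t 2^{L+2} (2L+7))` with `ℓ = |w|`,
`n' = decodeNat` of the second component of `w`, and `A_t` the integer refinement of the quadrant
numerators of the block counts of `y` (`levelNum`, `cnt_readControls`). This is the specification
the machine of `orderFindingPost_mem_FP` is verified against. [cite: Kitaev1995, §3 (Lemma 10, Thm 1) and §4] -/
theorem orderFindingPost_eq (z : List Bool) :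
    orderFindingPost z = encodeNat (univ.lcm fun t : Fin numTrials =>
      cfCandidate (decodeNat (boolUnpair (boolUnpair z).1).2) (qOf (boolUnpair z).1.length)
        (refineNat (levelNum (boolUnpair z).1.length (readControls (boolUnpair z).1.length (boolUnpair z).2) t)
          (numLevels (boolUnpair z).1.length) (numLevels (boolUnpair z).1.length - 1))
        (2 ^ (numLevels (boolUnpair z).1.length + 2)) (2 * (numLevels (boolUnpair z).1.length + 3) + 1)) := by
  unfold orderFindingPost
  rw [natPairEncoding_decode]
  simp only
  rw [orderEst_eq (sq_decode_le_qOf _)]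

end OFPostCF

end Literature.Computability.Cryptography

end
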